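import HarnessLib

/-!
# BirchSwinnertonDyer — rank ≥ 2 observatory: the `Ш[3]` column closed on the `3Ns` rows, check (b2) final,
and the `Ш[3]` budget / EXACT-mode re-runs (anom seat, gen 5) — DATA

HONEST FRAMING: per-curve certified theorems and census instruments; no claim on BSD in rank ≥ 2.

CENSUS DATA ONLY (REFEREE P6/R7: DATA-labelled `def`s, never theorems about elliptic curves). Every `def`
transcribes a number printed in `run/shared/lean/b2b/bsd-rank2-observatory/b2b-bsdr2-anom/CONSISTENCY-JOINS.md`
§"Gen 5 joins" and its machine-readable sources under `b2b-bsdr2-anom/joins-outputs/`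
(`desc3ns-j096087/DESC3NS-ANOM.summary.json`, `desc3-budget37-combined/…`, `desc3-exact-merged/…`,
`JOIN-B2-final.summary.json`, `SHA-PARTS-LEDGER.summary.json`; each records the sha256 of every input and of its
output; `b2b-bsdr2-anom/MANIFEST-CHECK.md` re-verifies all of them). The census
(358 159 curves of rank 2 and 3, `N < 5·10⁵`; consistent 358 159, anomalies under verification 0; `S = 1` on
358 117 rows, `S = 4` on 42) is the leaf `Rank2ObservatoryAnomCensus` (p213044); the gen-3 / gen-4 joins are
`Rank2ObservatoryAnomJoins` (p214942) and `Rank2ObservatoryAnomJoins2` (p216103); nothing here changes a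
census verdict.

* J3.7 — `Ш[3] = 0` UNCONDITIONALLY on the 159 `Ш[3]`-n/a rows whose 3-division polynomial is a product of two
  irreducible rational quadratics and whose class has no rational 3-isogeny (Cremona–Sutherland image `3Ns`
  ×147, CM ×12; all rank 2, `S = 1`), by the SIBLING cell's x10b engines run VERBATIM
  (`bsd-rank1-residual/X10B-DESC3NS.md` Theorem A: `H¹(ℚ,E[3]) ≅ ker(N : B^×/(B^×)³ → B⁺^×/(B⁺^×)³)` for the
  quartic field `B` of a point on the flex line pair, exact local conditions; `E(ℚ)[3] = 0` ⇒
  `dim Sel⁽³⁾ = r + dim Ш[3]`): engine 1 `desc3ns.gp` (certified class groups `bnfcertify = 1`, transfer check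
  between the two realisations) and engine 2 `desc3ns_e2.py` (independent implementation, also cross-checking
  engine 1's Selmer basis) on both realisations = 4 runs per curve, the sibling's PARI-free certificate verifier
  on all 318 certificate files, and the sibling's own validation table as a read-only third source.
* J3.9 — the high-budget Schaefer–Stoll re-run (`desc3`, verbatim sibling x11b engine, GRH class groups) of the 37
  surjective-mod-3-image rows left `n/a` by the gen-1/2 sampling budgets (job j093833 + follow-up j101463).
* J3.10 — an EXACT-mode spot-check (the same verbatim engine with `bnfcertify(A,1)` and 3-saturation switched on,
  jobs j097023 + j100674) of a deterministic conductor-stratified sample of 96 `GRH_BNF` rows: the certified rows become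
  unconditional, and no sampled row's exact `dim Sel₃` differs from its GRH value.
* J1-final — the two-engine join of check (b2) re-run unchanged after cert-3 completed tier T6
  (`4·10⁵ ≤ N < 5·10⁵`): every rank-2 and rank-3 census row is now two-engine on (b2).
* LEDGER (companion leaf `Rank2ObservatoryAnomLedger`) — `SHA-PARTS-LEDGER.tsv`: for every census curve the primes `p` at which `#Ш(E)[p^∞]` is a THEOREM
  (p = 2: complete 2-descents given the rank certificate; p = 3: the row's `Ш[3]`-column token; p ≥ 5: Kim
  AJM 148 Thm 1.8 on a unit Kurihara number, J4) and its agreement with `v_p(S)`; pure re-tabulation. Its summary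
  also records the precision profile of the census `S`-balls and a THIRD-SOURCE comparison of engine A's values of
  `S`, `L^{(r)}(E,1)/r!`, `Ω`, `Reg` with Cremona's `allbsd` (eclib, 15 digits) on every row.

Scripts: `code/b2b-bsdr2-anom/{desc3ns/, desc3/, desc3exact/, joins/collect_desc3ns.py, joins/join_b2.py,
joins/digest_sha_parts.py, verify_tree.py}` (READMEs, SHA256SUMS); jobs in `b2b-bsdr2-anom/JOBS.md`.
-/

namespace Summit.BirchSwinnertonDyer.BirchSwinnertonDyer.Rank2Observatory.AnomJoins3

/-- DATA (not a theorem): J3.7 — the `desc3ns` run on the `ψ₃ = q_a·q_b` rows. `rows` = curves run (`threeNs` with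
galrep code `3Ns` + `cm` CM curves with no galrep code), all of rank `2` with census `S = 1`; `runsPerCurve` = 2
engines × 2 realisations; `runsAllAgree` = curves whose 4 runs report the same `dim Sel⁽³⁾`; `dimSelEqRank` = curves
with `dim Sel⁽³⁾ = r = 2` and Mordell–Weil image of rank 2 on every run (⇒ `dim Ш[3] = 0`); `exact` = curves with
`bnfcertify = 1` on all engine-1 runs; `transferOk` = curves passing engine 1's side-1 ↔ side-2 transfer check in
both directions; `crossCheckOk` = engine-2 runs confirming engine 1's basis (2 per curve); `pairwiseComparisons` /
`pairwiseDifferences` = run-against-run comparisons of the combiner; `verifierFiles` / `verifierPass` = certificate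
files checked by the PARI-free verifier; `thirdSourceRows` / `thirdSourceAgree` = `3Ns` rows found (by label or
2-power-isogenous class-mate) in the sibling's `VAL3NS_table.tsv` with the same verdict (`thirdSourceSameLabel` by
identical label); `anomalyUnderVerification`; `job`; sha256 prefixes of the two engine files, of the input
`curves_all.txt` and of the output `DESC3NS-ANOM.tsv`. -/
structure Desc3Ns where
  rows : Nat
  threeNs : Nat
  cm : Nat
  rankTwo : Nat
  sOne : Nat
  runsPerCurve : Nat
  runsAllAgree : Nat
  dimSelEqRank : Nat
  exact : Nat
  transferOk : Nat
  crossCheckOk : Nat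
  pairwiseComparisons : Nat
  pairwiseDifferences : Nat
  verifierFiles : Nat
  verifierPass : Nat
  thirdSourceRows : Nat
  thirdSourceSameLabel : Nat
  thirdSourceAgree : Nat
  anomalyUnderVerification : Nat
  job : String
  engineOneSha256 : String
  engineTwoSha256 : String
  inputSha256 : String
  outputSha256 : String
  deriving Repr, DecidableEq

/-- DATA (not a theorem): `desc3ns-j096087/DESC3NS-ANOM.summary.json` + `tally.json` + `verify_purepython.log`. -/
def desc3Ns : Desc3Ns :=
  { rows := 159, threeNs := 147, cm := 12, rankTwo := 159, sOne := 159, runsPerCurve := 4, runsAllAgree := 159,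
    dimSelEqRank := 159, exact := 159, transferOk := 159, crossCheckOk := 318, pairwiseComparisons := 954,
    pairwiseDifferences := 0, verifierFiles := 318, verifierPass := 318, thirdSourceRows := 147,
    thirdSourceSameLabel := 137, thirdSourceAgree := 147, anomalyUnderVerification := 0, job := "j096087",
    engineOneSha256 := "5334dded4a661641", engineTwoSha256 := "9c2ffcc0e9dfe002",
    inputSha256 := "de4636337a952f66", outputSha256 := "92c67301522e2eca" }

example : desc3Ns.threeNs + desc3Ns.cm = desc3Ns.rows ∧ desc3Ns.rankTwo = desc3Ns.rows ∧ desc3Ns.sOne = desc3Ns.rows := by decide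
example : desc3Ns.runsAllAgree = desc3Ns.rows ∧ desc3Ns.dimSelEqRank = desc3Ns.rows ∧ desc3Ns.exact = desc3Ns.rows
    ∧ desc3Ns.transferOk = desc3Ns.rows := by decide
example : desc3Ns.crossCheckOk = 2 * desc3Ns.rows ∧ desc3Ns.verifierFiles = 2 * desc3Ns.rows
    ∧ desc3Ns.verifierPass = desc3Ns.verifierFiles := by decide
example : desc3Ns.pairwiseComparisons = 6 * desc3Ns.rows ∧ desc3Ns.pairwiseDifferences = 0
    ∧ desc3Ns.anomalyUnderVerification = 0 := by decide
example : desc3Ns.thirdSourceRows = desc3Ns.threeNs ∧ desc3Ns.thirdSourceAgree = desc3Ns.thirdSourceRows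
    ∧ desc3Ns.thirdSourceSameLabel ≤ desc3Ns.thirdSourceRows := by decide

/-! ## J3.9 — the 37 surjective-image rows over the gen-1/2 sampling budget, re-run at 10 800 s/curve (job j093833+j101463)

The 37 `Ш[3]`-n/a rows whose mod-3 image is surjective (34 of rank 2, 3 of rank 3) had exceeded the per-curve
budget of the gen-1/2 Schaefer–Stoll runs (900 s, then 2 400 s). Gen 3 re-submitted them VERBATIM through the gen-2
engine (`code/b2b-bsdr2-anom/desc3/`, `desc3lib.gp` = bsdres x11b gen-4, LOWERBOUND(GRH-equality) mode) at
`JOB_TOP = 10800` s under a 6-h wall (12 cores, one chunk of ≤ 4 curves per core, so at most two full attempts per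
chunk fit the wall; the rows it never reached were re-submitted by gen 5 one per worker: j101463 = the 2 `local image`
rows, done in 31 s; j101464 = the 11 `alarm` rows, running at the gen-5 hand-off and NOT counted here). A row that
returns `dim Sel₃ = r` (+ `dim E(ℚ)[3]` = 0 here) gets the census token `GRH_BNF`
(class groups of the octic étale algebra under GRH, as everywhere in the gen-1 column); rows killed at the budget or not
reached before the wall keep `SHA3_COLUMN_NA` with the budget documented. No anomaly under verification. -/

/-- DATA (not a theorem): outcome of the budget re-run: rows, by rank, rows with a Selmer row (`ok`), of these with
`dim Sel₃ = r` (lower bound `dim Ш[3] ≥ 0` sharp under GRH ⇒ token `GRH_BNF`), by rank, rows with a positive lower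
bound, rows killed by the supervisor at `topSeconds`, crashed, not reached before the 6-h wall, refused; rows that did not
finish but inherit `dim Ш[3] = 0` from an `ok` class-mate through an isogeny of degree prime to 3 (`allisog`); the largest
time of an `ok` row (s); sha256 prefix of `desc3.jsonl`. -/
structure Budget37 where
  rows : Nat
  rankTwo : Nat
  rankThree : Nat
  ok : Nat
  okShaZero : Nat
  okShaZeroRankTwo : Nat
  okShaZeroRankThree : Nat
  okLowerBoundPositive : Nat
  alarmKilled : Nat
  crashed : Nat
  notReached : Nat
  refusedOrError : Nat
  creditedViaIsogenyMate : Nat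
  topSeconds : Nat
  maxTimeOk : Nat
  job : String
  outputSha256 : String
  deriving Repr, DecidableEq

/-- DATA (not a theorem): `joins-outputs/desc3-budget37-combined/desc3.jsonl`. -/
def budget37 : Budget37 :=
  { rows := 37, rankTwo := 34, rankThree := 3, ok := 19, okShaZero := 19, okShaZeroRankTwo := 17,
    okShaZeroRankThree := 2, okLowerBoundPositive := 0, alarmKilled := 7, crashed := 0, notReached := 11,
    refusedOrError := 0, creditedViaIsogenyMate := 0, topSeconds := 10800, maxTimeOk := 7783, job := "j093833+j101463",
    outputSha256 := "b6fbce6f4a6bdf41" }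

example : budget37.ok + budget37.alarmKilled + budget37.crashed + budget37.notReached + budget37.refusedOrError = budget37.rows
    ∧ budget37.okShaZero + budget37.okLowerBoundPositive ≤ budget37.ok
    ∧ budget37.okShaZeroRankTwo + budget37.okShaZeroRankThree = budget37.okShaZero
    ∧ budget37.creditedViaIsogenyMate + budget37.ok ≤ budget37.rows
    ∧ budget37.rankTwo + budget37.rankThree = budget37.rows := by decide

/-! ## J3.10 — EXACT-mode spot-check of the `GRH_BNF` column on a stratified sample (job j097023+j100674)

The census `Ш[3]` column is an equality `dim Sel₃(E) = r` MODULO GRH on the `GRH_BNF` rows (class and unit groups of the octic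
étale algebra `A` computed by `bnfinit` without certification). The verbatim engine has an EXACT mode (its original one, x11b
gen 4): `bnfcertify(A,1) = 1` (the true class group is a quotient of the computed one) and 3-saturation of the computed
`S`-unit group by cubic residue characters (full column rank over `F₃`), after which the computed group IS `Sel₃(E/ℚ)` and
`dim Ш(E)[3] = dim Sel₃ − r − dim E(ℚ)[3] = 0` is unconditional. J3.10 re-ran a deterministic conductor-stratified sample of 96
`GRH_BNF` rows (rank 2: 36 with `N < 10⁴`, 24 in `[10⁴,10⁵)`, 24 in `[10⁵,5·10⁵)`; rank 3: 6 + 6; every ⌊n/q⌋-th eligible label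
in `(N, class, number)` order) in that mode at 1 500 s/curve (job j097023); the rows unfinished at 1 500 s were re-run one per worker. Token
at 3000 s (job j100674, J3.10b) and the two runs merged per label. `UNCONDITIONAL_3DESCENT_EXACT` on the certified rows; a `DIFF` between the exact and
the GRH dimension would be an anomaly under verification (none). -/

/-- DATA (not a theorem): the EXACT-sample run: rows and rows per stratum (`r2a` = rank 2, `N < 10⁴`; `r2b` = `[10⁴,10⁵)`;
`r2c` = `[10⁵,5·10⁵)`; `r3a`/`r3b` = rank 3 below/above `10⁵`), rows with a Selmer row (`ok`), of these EXACT-certified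
(`bnfcertify(A,1) = 1` ∧ 3-saturated), of these with `dim Sel₃ = r` (⇒ `Ш[3] = 0` unconditionally) in total and per stratum,
`ok` rows whose certification step did not complete (stay `GRH_BNF`), rows with `dim Sel₃ ≠ r` (`diff`), rows killed at
`topSeconds` (the largest per-curve budget used), other non-ok rows, `ok` rows contributed by the re-run; largest and total engine
time (ms) over the certified rows; sha256 prefixes of input and output. -/
structure ExactSample where
  rows : Nat
  r2a : Nat
  r2b : Nat
  r2c : Nat
  r3a : Nat
  r3b : Nat
  ok : Nat
  exactCertified : Nat
  unconditionalShaZero : Nat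
  uncR2a : Nat
  uncR2b : Nat
  uncR2c : Nat
  uncR3a : Nat
  uncR3b : Nat
  okNotCertified : Nat
  diff : Nat
  alarmKilled : Nat
  otherNotOk : Nat
  topSeconds : Nat
  rerunOk : Nat
  maxTimeCertifiedMs : Nat
  sumTimeCertifiedMs : Nat
  job : String
  inputSha256 : String
  outputSha256 : String
  deriving Repr, DecidableEq

/-- DATA (not a theorem): `joins-outputs/desc3-exact-merged/desc3.jsonl` (+ `curves_exact96.tsv`). -/
def exactSample : ExactSample :=
  { rows := 96, r2a := 36, r2b := 24, r2c := 24, r3a := 6, r3b := 6, ok := 74, exactCertified := 74,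
    unconditionalShaZero := 74, uncR2a := 36, uncR2b := 22, uncR2c := 10, uncR3a := 3, uncR3b := 3,
    okNotCertified := 0, diff := 0, alarmKilled := 22, otherNotOk := 0, topSeconds := 3000, rerunOk := 4,
    maxTimeCertifiedMs := 2806357, sumTimeCertifiedMs := 20620724, job := "j097023+j100674", inputSha256 := "facf287bbb430bf4",
    outputSha256 := "80e7126ce28df17b" }

example : exactSample.r2a + exactSample.r2b + exactSample.r2c + exactSample.r3a + exactSample.r3b = exactSample.rows
    ∧ exactSample.ok + exactSample.alarmKilled + exactSample.otherNotOk = exactSample.rows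
    ∧ exactSample.exactCertified + exactSample.okNotCertified = exactSample.ok
    ∧ exactSample.uncR2a + exactSample.uncR2b + exactSample.uncR2c + exactSample.uncR3a + exactSample.uncR3b = exactSample.unconditionalShaZero
    ∧ exactSample.unconditionalShaZero ≤ exactSample.exactCertified ∧ exactSample.rerunOk ≤ exactSample.ok ∧ exactSample.diff = 0 := by decide

/-! ## The `Ш[3]` column after gen 5

Tokens per census row after J3.7 (the 159 `ψ₃ = q_a·q_b` rows, `UNCONDITIONAL_3DESCENT_3NS_2E`), J3.9 (the budget
re-run: +19 rows decided) and J3.10 (74 sampled `GRH_BNF` rows made exact): `dim Ш(E)[3] = 0` on 358 141 rows — 339 810 modulo GRH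
(uncertified class groups) and 18 331 unconditionally (7 445 by the 3-isogeny Selmer pair, 10 572 + 81 by two exact general
engines, 159 by the sibling `desc3ns` pair, 74 by the exact Schaefer–Stoll run) — and no entry on 18 rows (surjective image,
over every budget tried). `3 ∤ S` on all
358 159 rows, so no row contradicts its column. -/

/-- DATA (not a theorem): the `Ш[3]` column of the census after gen 5, by hypothesis token. -/
structure Sha3ColumnG5 where
  grhBnf : Nat
  unconditionalIsogenyDescent : Nat
  unconditionalGeneralTwoEngineTwisted : Nat
  unconditionalGeneralTwoEngineTorsionClass : Nat
  unconditionalThreeNsTwoEngine : Nat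
  unconditionalExact : Nat
  noEntry : Nat
  deriving Repr, DecidableEq

/-- DATA (not a theorem): see `Sha3ColumnG5`; gen 3 had `grhBnf = 339865`, `noEntry = 196`. -/
def sha3ColumnG5 : Sha3ColumnG5 :=
  { grhBnf := 339810, unconditionalIsogenyDescent := 7445, unconditionalGeneralTwoEngineTwisted := 10572,
    unconditionalGeneralTwoEngineTorsionClass := 81, unconditionalThreeNsTwoEngine := 159, unconditionalExact := 74, noEntry := 18 }

/-- Bookkeeping: the unconditional part of the column. -/
def Sha3ColumnG5.unconditional (c : Sha3ColumnG5) : Nat :=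
  c.unconditionalIsogenyDescent + c.unconditionalGeneralTwoEngineTwisted + c.unconditionalGeneralTwoEngineTorsionClass
    + c.unconditionalThreeNsTwoEngine + c.unconditionalExact

example : sha3ColumnG5.grhBnf + sha3ColumnG5.unconditional + sha3ColumnG5.noEntry = 358159
    ∧ sha3ColumnG5.unconditional = 18257 + sha3ColumnG5.unconditionalExact
    ∧ sha3ColumnG5.unconditionalThreeNsTwoEngine = desc3Ns.rows
    ∧ sha3ColumnG5.unconditionalExact = exactSample.unconditionalShaZero
    ∧ sha3ColumnG5.grhBnf + sha3ColumnG5.unconditionalExact = 339865 + budget37.okShaZero + budget37.creditedViaIsogenyMate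
    ∧ sha3ColumnG5.noEntry + budget37.okShaZero + budget37.creditedViaIsogenyMate + desc3Ns.rows = 196 := by decide

/-! ## J1-final — check (b2) by two engines on every row (re-run after cert-3 completed tier 6)

`join_b2.py` re-run of 2026-08-20T12:08:00Z on cert-3's complete `R2-SEL2-desc2lib/T1…T6` AGREEMENT tables (tier 6 =
`[4·10⁵, 5·10⁵)`, 74 326 rows) and cert-2's `R3-SEL2`: engine A (`ellrank`) × engine B (`desc2lib`, mwrank-free
2-descent) (× engine F = `desc4lib` on the 42 `S = 4` rows). Output `joins-outputs/JOIN-B2-final.tsv.gz`. -/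

/-- DATA (not a theorem): J1-final per conductor band `[lo·10⁵, hi·10⁵)`, rank 2: rows, two-engine rows, one-engine rows
(`JOIN-B2-final.summary.json: coverage.rank2_by_band`). -/
structure B2Band where
  lo : Nat
  hi : Nat
  rows : Nat
  twoEngine : Nat
  oneEngine : Nat
  deriving Repr, DecidableEq

/-- DATA (not a theorem): see `B2Band`. -/
def b2BandsFinal : List B2Band := [
  { lo := 0, hi := 1, rows := 56975, twoEngine := 56975, oneEngine := 0 },
  { lo := 1, hi := 2, rows := 69868, twoEngine := 69868, oneEngine := 0 },
  { lo := 2, hi := 3, rows := 72987, twoEngine := 72987, oneEngine := 0 },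
  { lo := 3, hi := 4, rows := 74516, twoEngine := 74516, oneEngine := 0 },
  { lo := 4, hi := 5, rows := 74326, twoEngine := 74326, oneEngine := 0 } ]

/-- DATA (not a theorem): J1-final totals: census rows, engine-B AGREEMENT rows read per tier (T1…T6, canary) and from
`R3-SEL2`, two-engine rows by rank, one-engine rows, anomalies under verification, incomplete rows, the largest `N` of a
two-engine rank-2 row, sha256 prefix of the uncompressed TSV. -/
structure B2JoinFinal where
  rows : Nat
  engineBRowsT1 : Nat
  engineBRowsT2 : Nat
  engineBRowsT3 : Nat
  engineBRowsT4 : Nat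
  engineBRowsT5 : Nat
  engineBRowsT6 : Nat
  engineBRowsCanary : Nat
  engineBRowsR3 : Nat
  twoEngineRankTwo : Nat
  twoEngineRankThree : Nat
  oneEngineRankTwo : Nat
  anomaly : Nat
  incomplete : Nat
  maxNRankTwoTwoEngine : Nat
  outputSha256 : String
  deriving Repr, DecidableEq

/-- DATA (not a theorem): `JOIN-B2-final.summary.json` totals. -/
def b2JoinFinal : B2JoinFinal :=
  { rows := 358159, engineBRowsT1 := 23612, engineBRowsT2 := 33363, engineBRowsT3 := 69868, engineBRowsT4 := 72987, engineBRowsT5 := 74516,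
    engineBRowsT6 := 74326, engineBRowsCanary := 290, engineBRowsR3 := 9487, twoEngineRankTwo := 348672, twoEngineRankThree := 9487,
    oneEngineRankTwo := 0, anomaly := 0, incomplete := 0, maxNRankTwoTwoEngine := 499998, outputSha256 := "d30536fc48d8521c" }

example : (b2BandsFinal.map (·.rows)).sum = b2JoinFinal.twoEngineRankTwo + b2JoinFinal.oneEngineRankTwo
    ∧ (b2BandsFinal.map (·.twoEngine)).sum = b2JoinFinal.twoEngineRankTwo
    ∧ (b2BandsFinal.map (·.oneEngine)).sum = b2JoinFinal.oneEngineRankTwo := by decide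
example : b2JoinFinal.twoEngineRankTwo + b2JoinFinal.oneEngineRankTwo + b2JoinFinal.twoEngineRankThree = b2JoinFinal.rows
    ∧ b2JoinFinal.anomaly = 0 ∧ b2JoinFinal.incomplete = 0 := by decide
example : b2JoinFinal.engineBRowsT1 + b2JoinFinal.engineBRowsT2 + b2JoinFinal.engineBRowsT3 + b2JoinFinal.engineBRowsT4
    + b2JoinFinal.engineBRowsT5 + b2JoinFinal.engineBRowsT6 = b2JoinFinal.twoEngineRankTwo := by decide

end Summit.BirchSwinnertonDyer.BirchSwinnertonDyer.Rank2Observatory.AnomJoins3
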